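import Summits.Ventures.Crystal3D.Theorems.StickyWulffConstantTextureLiminfCellFlux
import HarnessLib

/-!
# The layer strips of a tilted plate inside the unit wall slice: TOTAL VARIATION of the strip volumes is `O(ρ / sin β)`
# (lane T, crux `TextureLiminfV5`, stmt-Ventures-23912, EDGE-ON flux class, the ADJACENT-MEAN flux count of cf-p1 (cci); 19480-p1 g16)

HONEST FRAMING. Venture `Summits/Ventures/Crystal3D` (cell `crystal3d-full`), route `route-Ventures-StickyWulffConstant`, helper
`--supports` the law-v5 crux `TextureLiminfV5` (stmt-Ventures-23912).  Pure measure theory on the wall slice; standard axioms; no walker,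
no certificate, no wall law; rung F-C1 not moved.

THE POINT (HOME/wall-p1-g16/ALPHA-ANSWER.md §3, cf-p1 (cci)).  The T-side flux identity `plate_lines_ge_flux_up` certifies
`Σ_i √2·r_i · |S ∩ laySlab L s i| ≤ #T` for the step rises `r_i` of one plate; the ADJACENT-MEAN count replaces `r_i` by `½(r_i + r_{i+1})`,
which is legitimate up to `½·max r · Σ_i | |S ∩ laySlab_i| − |S ∩ laySlab_{i+1}| |`.  This file bounds that total variation for the unit wall slice
`S = wallSlice ρ = {0 ≤ q₂ ≤ 1, q₀² + q₁² ≤ ρ²}`: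
* `height_eq_inner` — the plate height of a point is `⟪y − s, L e₃⟫`;
* `mem_laySlab_succ_iff` — consecutive layer slabs are HORIZONTAL translates of each other: `laySlab L s (i+1) = laySlab L s i + t` with
  `t = (hB/ℓ²)·(n₀, n₁, 0)`, `n = L e₃`, `ℓ² = n₀² + n₁²` (the slab is invariant under translations orthogonal to `n`, and `⟪t, n⟫ = hB`);
* `volume_wallSlice_diff_shift_le` — a horizontal shift by `t` changes the slice by at most a crescent: `|S ∖ (S − t)| ≤ 2π·ρ·‖t‖`;
* **`tsum_abs_sub_volume_wallSlice_laySlab_le`** — `Σ_i | |S ∩ laySlab_i| − |S ∩ laySlab_{i+1}| | ≤ 4π·ρ·hB/ℓ` (`ℓ = sin β > 0`, `β` the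
  angle between the plate axis and the wall normal; uniform on the edge-on regime);
* **`tsum_adjMean_mul_volume_le`** — the corollary the `_adj` glue consumes: for `0 ≤ r_i ≤ R`,
  `Σ_i ½(r_i + r_{i+1})·|S ∩ laySlab_i| ≤ Σ_i r_i·|S ∩ laySlab_i| + (R/2)·4π·ρ·hB/ℓ`.
WHAT THIS IS NOT: not the `_adj` cell glue (19480-p2 / wulff-p2 after the critique (cci)(i)–(iii)); F-C1 not moved.
-/

noncomputable section

namespace Summit.Ventures.Crystal3D.Theorems

open MeasureTheory Set
open scoped ENNReal InnerProductSpace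
open Summit.Ventures.Crystal3D.Cruxes.TextureLiminf.TexShadow (E3 e₃ laySlab)
open Summit.Ventures.Crystal3D.TentCertificate (height hB hB_pos mem_laySlab_iff)

/-! ## Heights and the horizontal shift between consecutive layer slabs -/

/-- The plate height of `y` in the frame `(L, s)` is the inner product with the plate axis: `height L s y = ⟪y − s, L e₃⟫`. -/
theorem height_eq_inner (L : E3 ≃ₗᵢ[ℝ] E3) (s y : E3) : height L s y = ⟪y - s, L e₃⟫_ℝ := by
  unfold height
  have he3 : (e₃ : E3) = EuclideanSpace.single (2 : Fin 3) (1 : ℝ) := rfl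
  rw [← LinearIsometryEquiv.inner_map_map L.symm (y - s) (L e₃), LinearIsometryEquiv.symm_apply_apply, he3,
    EuclideanSpace.inner_single_right]
  simp

/-- The horizontal shift vector `t = (hB/ℓ²)·(n₀, n₁, 0)` of the frame `L` (`n = L e₃`, `ℓ² = n₀² + n₁²`). -/
theorem inner_latShift_axis (L : E3 ≃ₗᵢ[ℝ] E3) (hℓ : 0 < (L e₃) 0 ^ 2 + (L e₃) 1 ^ 2) :
    ⟪(hB / ((L e₃) 0 ^ 2 + (L e₃) 1 ^ 2)) •
        (EuclideanSpace.single (0 : Fin 3) ((L e₃) 0) + EuclideanSpace.single (1 : Fin 3) ((L e₃) 1) : E3), L e₃⟫_ℝ = hB := by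
  rw [real_inner_smul_left, inner_add_left, EuclideanSpace.inner_single_left, EuclideanSpace.inner_single_left]
  simp only [conj_trivial]
  field_simp

/-- The shift vector is horizontal. -/
theorem latShift_apply_two (L : E3 ≃ₗᵢ[ℝ] E3) :
    ((hB / ((L e₃) 0 ^ 2 + (L e₃) 1 ^ 2)) •
        (EuclideanSpace.single (0 : Fin 3) ((L e₃) 0) + EuclideanSpace.single (1 : Fin 3) ((L e₃) 1) : E3)) 2 = 0 := by
  simp

/-- The squared norm of the shift vector is `hB²/ℓ²`. -/
theorem norm_latShift_sq (L : E3 ≃ₗᵢ[ℝ] E3) (hℓ : 0 < (L e₃) 0 ^ 2 + (L e₃) 1 ^ 2) :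
    ‖(hB / ((L e₃) 0 ^ 2 + (L e₃) 1 ^ 2)) •
        (EuclideanSpace.single (0 : Fin 3) ((L e₃) 0) + EuclideanSpace.single (1 : Fin 3) ((L e₃) 1) : E3)‖ ^ 2 =
      hB ^ 2 / ((L e₃) 0 ^ 2 + (L e₃) 1 ^ 2) := by
  rw [norm_smul, mul_pow, Real.norm_eq_abs, sq_abs, EuclideanSpace.norm_eq, Real.sq_sqrt (Finset.sum_nonneg fun i _ => sq_nonneg _),
    Fin.sum_univ_three]
  simp
  field_simp

/-- **Consecutive layer slabs are horizontal translates**: `y ∈ laySlab L s (i+1) ↔ y − t ∈ laySlab L s i`. -/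
theorem mem_laySlab_succ_iff (L : E3 ≃ₗᵢ[ℝ] E3) (s : E3) (hℓ : 0 < (L e₃) 0 ^ 2 + (L e₃) 1 ^ 2) (i : ℤ) (y : E3) :
    y ∈ laySlab L s (i + 1) ↔
      y - (hB / ((L e₃) 0 ^ 2 + (L e₃) 1 ^ 2)) •
          (EuclideanSpace.single (0 : Fin 3) ((L e₃) 0) + EuclideanSpace.single (1 : Fin 3) ((L e₃) 1) : E3) ∈ laySlab L s i := by
  set t : E3 := (hB / ((L e₃) 0 ^ 2 + (L e₃) 1 ^ 2)) •
    (EuclideanSpace.single (0 : Fin 3) ((L e₃) 0) + EuclideanSpace.single (1 : Fin 3) ((L e₃) 1) : E3) with ht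
  have hshift : height L s (y - t) = height L s y - hB := by
    rw [height_eq_inner, height_eq_inner, show y - t - s = (y - s) - t by abel, inner_sub_left, ht, inner_latShift_axis L hℓ]
  rw [mem_laySlab_iff, mem_laySlab_iff, hshift]
  push_cast
  constructor <;> rintro ⟨h1, h2⟩ <;> constructor <;> linarith

/-! ## Volumes: translation and the crescent bound -/

/-- Translating the set being sliced: `|A ∩ laySlab L s (i+1)| = |(A − t) ∩ laySlab L s i|` with `A − t = (· + t)⁻¹ A`. -/
theorem volume_inter_laySlab_succ (L : E3 ≃ₗᵢ[ℝ] E3) (s : E3) (hℓ : 0 < (L e₃) 0 ^ 2 + (L e₃) 1 ^ 2) (A : Set E3)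
    (hA : MeasurableSet A) (i : ℤ) :
    volume (A ∩ laySlab L s (i + 1)) =
      volume (((fun z : E3 => z + (hB / ((L e₃) 0 ^ 2 + (L e₃) 1 ^ 2)) •
          (EuclideanSpace.single (0 : Fin 3) ((L e₃) 0) + EuclideanSpace.single (1 : Fin 3) ((L e₃) 1) : E3)) ⁻¹' A) ∩
        laySlab L s i) := by
  set t : E3 := (hB / ((L e₃) 0 ^ 2 + (L e₃) 1 ^ 2)) •
    (EuclideanSpace.single (0 : Fin 3) ((L e₃) 0) + EuclideanSpace.single (1 : Fin 3) ((L e₃) 1) : E3) with ht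
  have hψ : MeasurePreserving (fun y : E3 => y - t) volume volume := measurePreserving_sub_right volume t
  have hset : A ∩ laySlab L s (i + 1) = (fun y : E3 => y - t) ⁻¹' (((fun z : E3 => z + t) ⁻¹' A) ∩ laySlab L s i) := by
    ext y
    simp only [Set.mem_inter_iff, Set.mem_preimage, sub_add_cancel]
    rw [mem_laySlab_succ_iff L s hℓ i y]
  have hmeas : MeasurableSet (((fun z : E3 => z + t) ⁻¹' A) ∩ laySlab L s i) :=
    ((measurable_add_const t) hA).inter (measurableSet_laySlab L s i)
  rw [hset, hψ.measure_preimage hmeas.nullMeasurableSet]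

/-- The cylinder of radius `ρ − τ` over `[0,1]` lies inside the shifted slice `(· + u)⁻¹ (wallSlice ρ)` for a horizontal `u` of length `≤ τ ≤ ρ`. -/
theorem cyl_subset_preimage_wallSlice {ρ τ : ℝ} {u : E3} (hu2 : u 2 = 0) (hτ : u 0 ^ 2 + u 1 ^ 2 ≤ τ ^ 2) (hτ0 : 0 ≤ τ)
    (hτρ : τ ≤ ρ) :
    {y : E3 | y 0 ^ 2 + y 1 ^ 2 ≤ (ρ - τ) ^ 2 ∧ 0 ≤ y 2 ∧ y 2 ≤ 1} ⊆ (fun z : E3 => z + u) ⁻¹' wallSlice ρ := by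
  rintro y ⟨hy, hy0, hy1⟩
  simp only [Set.mem_preimage, wallSlice, Set.mem_setOf_eq, PiLp.add_apply, hu2, add_zero]
  refine ⟨hy0, hy1, ?_⟩
  -- ‖y_lat + u_lat‖ ≤ ‖y_lat‖ + ‖u_lat‖ ≤ (ρ − τ) + τ
  set a : ℝ := Real.sqrt (y 0 ^ 2 + y 1 ^ 2) with ha_def
  set b : ℝ := Real.sqrt (u 0 ^ 2 + u 1 ^ 2) with hb_def
  have ha0 : 0 ≤ a := Real.sqrt_nonneg _
  have hb0 : 0 ≤ b := Real.sqrt_nonneg _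
  have ha2 : a ^ 2 = y 0 ^ 2 + y 1 ^ 2 := Real.sq_sqrt (by positivity)
  have hb2 : b ^ 2 = u 0 ^ 2 + u 1 ^ 2 := Real.sq_sqrt (by positivity)
  have ha : a ≤ ρ - τ := by
    have := Real.sqrt_le_sqrt hy
    rwa [Real.sqrt_sq (by linarith)] at this
  have hb : b ≤ τ := by
    have := Real.sqrt_le_sqrt hτ
    rwa [Real.sqrt_sq hτ0] at this
  have hcs : y 0 * u 0 + y 1 * u 1 ≤ a * b := by
    have h1 : (y 0 * u 0 + y 1 * u 1) ^ 2 ≤ (a * b) ^ 2 := by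
      rw [mul_pow, ha2, hb2]; nlinarith [sq_nonneg (y 0 * u 1 - y 1 * u 0)]
    have h2 : |y 0 * u 0 + y 1 * u 1| ≤ a * b := by
      rw [← Real.sqrt_sq_eq_abs, ← Real.sqrt_sq (mul_nonneg ha0 hb0)]
      exact Real.sqrt_le_sqrt h1
    exact (le_abs_self _).trans h2
  nlinarith [mul_nonneg ha0 hb0]

/-- **The crescent bound**: for a horizontal shift `u` of length `≤ τ`, `|wallSlice ρ ∖ (· + u)⁻¹(wallSlice ρ)| ≤ 2π·ρ·τ`. -/
theorem volume_wallSlice_diff_shift_le {ρ τ : ℝ} (hρ : 0 ≤ ρ) {u : E3} (hu2 : u 2 = 0) (hτ : u 0 ^ 2 + u 1 ^ 2 ≤ τ ^ 2)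
    (hτ0 : 0 ≤ τ) :
    volume (wallSlice ρ \ (fun z : E3 => z + u) ⁻¹' wallSlice ρ) ≤ ENNReal.ofReal (2 * Real.pi * ρ * τ) := by
  by_cases hτρ : τ ≤ ρ
  · -- remove the inner cylinder of radius ρ − τ
    set C : Set E3 := {y : E3 | y 0 ^ 2 + y 1 ^ 2 ≤ (ρ - τ) ^ 2 ∧ 0 ≤ y 2 ∧ y 2 ≤ 1} with hC
    have hCsub : C ⊆ (fun z : E3 => z + u) ⁻¹' wallSlice ρ := cyl_subset_preimage_wallSlice hu2 hτ hτ0 hτρ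
    have hCW : C ⊆ wallSlice ρ := by
      rintro y ⟨hy, hy0, hy1⟩; exact ⟨hy0, hy1, hy.trans (by nlinarith)⟩
    have hsub : wallSlice ρ \ (fun z : E3 => z + u) ⁻¹' wallSlice ρ ⊆ wallSlice ρ \ C := fun y hy => ⟨hy.1, fun h => hy.2 (hCsub h)⟩
    have hCmeas : MeasurableSet C := measurableSet_cyl (ρ - τ) 0 1
    have hCvol : volume C = ENNReal.ofReal (Real.pi * (ρ - τ) ^ 2) := by
      rw [hC, volume_cyl (ρ - τ) 0 1 (by linarith), sub_zero, ENNReal.ofReal_one, one_mul, ← ENNReal.ofReal_pow (by linarith),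
        ← ENNReal.ofReal_mul (by positivity), mul_comm]
    have hCfin : volume C ≠ ⊤ := by rw [hCvol]; exact ENNReal.ofReal_ne_top
    calc volume (wallSlice ρ \ (fun z : E3 => z + u) ⁻¹' wallSlice ρ) ≤ volume (wallSlice ρ \ C) := measure_mono hsub
      _ = volume (wallSlice ρ) - volume C := measure_sdiff hCW hCmeas.nullMeasurableSet hCfin
      _ = ENNReal.ofReal (Real.pi * ρ ^ 2) - ENNReal.ofReal (Real.pi * (ρ - τ) ^ 2) := by rw [volume_wallSlice ρ hρ, hCvol]
      _ = ENNReal.ofReal (Real.pi * ρ ^ 2 - Real.pi * (ρ - τ) ^ 2) := (ENNReal.ofReal_sub _ (by positivity)).symm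
      _ ≤ ENNReal.ofReal (2 * Real.pi * ρ * τ) := ENNReal.ofReal_le_ofReal (by nlinarith [Real.pi_pos, sq_nonneg τ])
  · -- τ > ρ: the whole slice is smaller than the bound
    have hlt : ρ < τ := lt_of_not_ge hτρ
    calc volume (wallSlice ρ \ (fun z : E3 => z + u) ⁻¹' wallSlice ρ) ≤ volume (wallSlice ρ) := measure_mono fun y hy => hy.1
      _ = ENNReal.ofReal (Real.pi * ρ ^ 2) := volume_wallSlice ρ hρ
      _ ≤ ENNReal.ofReal (2 * Real.pi * ρ * τ) := ENNReal.ofReal_le_ofReal (by nlinarith [Real.pi_pos, mul_nonneg Real.pi_pos.le hρ])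

/-- **The symmetric-difference bound**: `|wallSlice ρ Δ (· + u)⁻¹(wallSlice ρ)| ≤ 4π·ρ·τ` for a horizontal `u` of length `≤ τ`. -/
theorem volume_wallSlice_symmDiff_shift_le {ρ τ : ℝ} (hρ : 0 ≤ ρ) {u : E3} (hu2 : u 2 = 0) (hτ : u 0 ^ 2 + u 1 ^ 2 ≤ τ ^ 2)
    (hτ0 : 0 ≤ τ) :
    volume (symmDiff (wallSlice ρ) ((fun z : E3 => z + u) ⁻¹' wallSlice ρ)) ≤ ENNReal.ofReal (4 * Real.pi * ρ * τ) := by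
  have h1 := volume_wallSlice_diff_shift_le hρ hu2 hτ hτ0
  -- the other difference is a translate of `wallSlice ρ ∖ (· − u)⁻¹(wallSlice ρ)`
  have hneg2 : (-u) 2 = 0 := by simp [hu2]
  have hnegτ : (-u) 0 ^ 2 + (-u) 1 ^ 2 ≤ τ ^ 2 := by simpa using hτ
  have h2' := volume_wallSlice_diff_shift_le hρ hneg2 hnegτ hτ0
  have hψ : MeasurePreserving (fun y : E3 => y + u) volume volume := measurePreserving_add_right volume u
  have hset : (fun z : E3 => z + u) ⁻¹' wallSlice ρ \ wallSlice ρ =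
      (fun y : E3 => y + u) ⁻¹' (wallSlice ρ \ (fun z : E3 => z + -u) ⁻¹' wallSlice ρ) := by
    ext y; simp
  have hmeas : MeasurableSet (wallSlice ρ \ (fun z : E3 => z + -u) ⁻¹' wallSlice ρ) :=
    (measurableSet_wallSlice ρ).diff ((measurable_add_const (-u)) (measurableSet_wallSlice ρ))
  have h2 : volume ((fun z : E3 => z + u) ⁻¹' wallSlice ρ \ wallSlice ρ) ≤ ENNReal.ofReal (2 * Real.pi * ρ * τ) := by
    rw [hset, hψ.measure_preimage hmeas.nullMeasurableSet]; exact h2'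
  rw [Set.symmDiff_def]
  calc volume (wallSlice ρ \ (fun z : E3 => z + u) ⁻¹' wallSlice ρ ∪ ((fun z : E3 => z + u) ⁻¹' wallSlice ρ \ wallSlice ρ))
      ≤ volume (wallSlice ρ \ (fun z : E3 => z + u) ⁻¹' wallSlice ρ) + volume ((fun z : E3 => z + u) ⁻¹' wallSlice ρ \ wallSlice ρ) :=
        measure_union_le _ _
    _ ≤ ENNReal.ofReal (2 * Real.pi * ρ * τ) + ENNReal.ofReal (2 * Real.pi * ρ * τ) := add_le_add h1 h2
    _ = ENNReal.ofReal (4 * Real.pi * ρ * τ) := by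
        rw [← ENNReal.ofReal_add (by positivity) (by positivity)]; ring_nf

/-! ## The total variation of the strip volumes -/

/-- `| |A ∩ B| − |A' ∩ B| | ≤ |(A Δ A') ∩ B|` for sets of finite measure. -/
theorem abs_toReal_volume_inter_sub_le {A A' B : Set E3} (hA : volume A ≠ ⊤) (hA' : volume A' ≠ ⊤) :
    |(volume (A ∩ B)).toReal - (volume (A' ∩ B)).toReal| ≤ (volume (symmDiff A A' ∩ B)).toReal := by
  have hfin1 : volume (A ∩ B) ≠ ⊤ := measure_ne_top_of_subset Set.inter_subset_left hA
  have hfin2 : volume (A' ∩ B) ≠ ⊤ := measure_ne_top_of_subset Set.inter_subset_left hA'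
  have hfin3 : volume (symmDiff A A' ∩ B) ≠ ⊤ := by
    refine measure_ne_top_of_subset Set.inter_subset_left ?_
    rw [Set.symmDiff_def]
    exact (measure_union_lt_top (measure_lt_top_of_subset (fun y hy => hy.1) hA) (measure_lt_top_of_subset (fun y hy => hy.1) hA')).ne
  have hle1 : volume (A ∩ B) ≤ volume (A' ∩ B) + volume (symmDiff A A' ∩ B) := by
    calc volume (A ∩ B) ≤ volume ((A' ∩ B) ∪ (symmDiff A A' ∩ B)) := by
          refine measure_mono fun y ⟨hyA, hyB⟩ => ?_
          by_cases hyA' : y ∈ A'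
          · exact Or.inl ⟨hyA', hyB⟩
          · exact Or.inr ⟨by rw [Set.symmDiff_def]; exact Or.inl ⟨hyA, hyA'⟩, hyB⟩
      _ ≤ volume (A' ∩ B) + volume (symmDiff A A' ∩ B) := measure_union_le _ _
  have hle2 : volume (A' ∩ B) ≤ volume (A ∩ B) + volume (symmDiff A A' ∩ B) := by
    calc volume (A' ∩ B) ≤ volume ((A ∩ B) ∪ (symmDiff A A' ∩ B)) := by
          refine measure_mono fun y ⟨hyA', hyB⟩ => ?_
          by_cases hyA : y ∈ A
          · exact Or.inl ⟨hyA, hyB⟩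
          · exact Or.inr ⟨by rw [Set.symmDiff_def]; exact Or.inr ⟨hyA', hyA⟩, hyB⟩
      _ ≤ volume (A ∩ B) + volume (symmDiff A A' ∩ B) := measure_union_le _ _
  have t1 : (volume (A ∩ B)).toReal ≤ (volume (A' ∩ B)).toReal + (volume (symmDiff A A' ∩ B)).toReal := by
    have := ENNReal.toReal_mono (ENNReal.add_ne_top.2 ⟨hfin2, hfin3⟩) hle1
    rwa [ENNReal.toReal_add hfin2 hfin3] at this
  have t2 : (volume (A' ∩ B)).toReal ≤ (volume (A ∩ B)).toReal + (volume (symmDiff A A' ∩ B)).toReal := by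
    have := ENNReal.toReal_mono (ENNReal.add_ne_top.2 ⟨hfin1, hfin3⟩) hle2
    rwa [ENNReal.toReal_add hfin1 hfin3] at this
  rw [abs_le]; constructor <;> linarith

/-- **TOTAL VARIATION OF THE STRIP VOLUMES.**  For the unit wall slice `S = wallSlice ρ` (`ρ ≥ 0`) and a plate frame `(L, s)` whose axis is not
the wall normal (`ℓ² = (L e₃)₀² + (L e₃)₁² > 0`, `ℓ = sin β`):
`Σ_i | |S ∩ laySlab L s i| − |S ∩ laySlab L s (i+1)| | ≤ 4π·ρ·hB/ℓ` (and the series converges). -/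
theorem tsum_abs_sub_volume_wallSlice_laySlab_le (L : E3 ≃ₗᵢ[ℝ] E3) (s : E3) {ρ : ℝ} (hρ : 0 ≤ ρ)
    (hℓ : 0 < (L e₃) 0 ^ 2 + (L e₃) 1 ^ 2) :
    Summable (fun i : ℤ => |(volume (wallSlice ρ ∩ laySlab L s i)).toReal - (volume (wallSlice ρ ∩ laySlab L s (i + 1))).toReal|) ∧
    ∑' i : ℤ, |(volume (wallSlice ρ ∩ laySlab L s i)).toReal - (volume (wallSlice ρ ∩ laySlab L s (i + 1))).toReal| ≤
      4 * Real.pi * ρ * (hB / Real.sqrt ((L e₃) 0 ^ 2 + (L e₃) 1 ^ 2)) := by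
  set t : E3 := (hB / ((L e₃) 0 ^ 2 + (L e₃) 1 ^ 2)) •
    (EuclideanSpace.single (0 : Fin 3) ((L e₃) 0) + EuclideanSpace.single (1 : Fin 3) ((L e₃) 1) : E3) with ht
  set A : Set E3 := wallSlice ρ with hAdef
  set A' : Set E3 := (fun z : E3 => z + t) ⁻¹' wallSlice ρ with hA'def
  have hAm : MeasurableSet A := measurableSet_wallSlice ρ
  have hA'm : MeasurableSet A' := (measurable_add_const t) (measurableSet_wallSlice ρ)
  have hAfin : volume A ≠ ⊤ := by rw [hAdef, volume_wallSlice ρ hρ]; exact ENNReal.ofReal_ne_top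
  have hA'vol : volume A' = volume (wallSlice ρ) := (measurePreserving_add_right volume t).measure_preimage hAm.nullMeasurableSet
  have hA'fin : volume A' ≠ ⊤ := by rw [hA'vol, volume_wallSlice ρ hρ]; exact ENNReal.ofReal_ne_top
  -- the shift length τ = hB/ℓ
  set τ : ℝ := hB / Real.sqrt ((L e₃) 0 ^ 2 + (L e₃) 1 ^ 2) with hτ
  have hℓ0 : 0 < Real.sqrt ((L e₃) 0 ^ 2 + (L e₃) 1 ^ 2) := Real.sqrt_pos.2 hℓ
  have hτ0 : 0 ≤ τ := div_nonneg hB_pos.le hℓ0.le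
  have ht2 : t 2 = 0 := latShift_apply_two L
  have htτ : t 0 ^ 2 + t 1 ^ 2 ≤ τ ^ 2 := by
    have hn : ‖t‖ ^ 2 = hB ^ 2 / ((L e₃) 0 ^ 2 + (L e₃) 1 ^ 2) := norm_latShift_sq L hℓ
    have hn' : ‖t‖ ^ 2 = t 0 ^ 2 + t 1 ^ 2 + t 2 ^ 2 := by
      rw [EuclideanSpace.norm_eq, Real.sq_sqrt (Finset.sum_nonneg fun i _ => sq_nonneg _), Fin.sum_univ_three]
      simp only [Real.norm_eq_abs, sq_abs]
    have hτ2 : τ ^ 2 = hB ^ 2 / ((L e₃) 0 ^ 2 + (L e₃) 1 ^ 2) := by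
      rw [hτ, div_pow, Real.sq_sqrt hℓ.le]
    rw [hτ2, ← hn, hn', ht2]; nlinarith
  -- the symmetric difference, sliced by the layer slabs
  have hΔ : volume (symmDiff A A') ≤ ENNReal.ofReal (4 * Real.pi * ρ * τ) := volume_wallSlice_symmDiff_shift_le hρ ht2 htτ hτ0
  have hΔm : MeasurableSet (symmDiff A A') := hAm.symmDiff hA'm
  have hΔsum : volume (symmDiff A A') = ∑' i : ℤ, volume (symmDiff A A' ∩ laySlab L s i) := measure_eq_tsum_inter_laySlab L s _ hΔm
  have hΔfin : ∑' i : ℤ, volume (symmDiff A A' ∩ laySlab L s i) ≠ ⊤ := by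
    rw [← hΔsum]; exact (hΔ.trans_lt ENNReal.ofReal_lt_top).ne
  have hterm_fin : ∀ i : ℤ, volume (symmDiff A A' ∩ laySlab L s i) ≠ ⊤ := fun i =>
    ne_top_of_le_ne_top hΔfin (ENNReal.le_tsum i)
  have hsumm : Summable fun i : ℤ => (volume (symmDiff A A' ∩ laySlab L s i)).toReal := ENNReal.summable_toReal hΔfin
  -- termwise comparison
  have hstep : ∀ i : ℤ, volume (A ∩ laySlab L s (i + 1)) = volume (A' ∩ laySlab L s i) := fun i =>
    volume_inter_laySlab_succ L s hℓ (wallSlice ρ) hAm i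
  have hle : ∀ i : ℤ, |(volume (A ∩ laySlab L s i)).toReal - (volume (A ∩ laySlab L s (i + 1))).toReal| ≤
      (volume (symmDiff A A' ∩ laySlab L s i)).toReal := fun i => by
    rw [hstep i]; exact abs_toReal_volume_inter_sub_le hAfin hA'fin
  have hsumm' : Summable fun i : ℤ => |(volume (A ∩ laySlab L s i)).toReal - (volume (A ∩ laySlab L s (i + 1))).toReal| :=
    Summable.of_nonneg_of_le (fun i => abs_nonneg _) hle hsumm
  refine ⟨hsumm', ?_⟩
  calc ∑' i : ℤ, |(volume (A ∩ laySlab L s i)).toReal - (volume (A ∩ laySlab L s (i + 1))).toReal|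
      ≤ ∑' i : ℤ, (volume (symmDiff A A' ∩ laySlab L s i)).toReal := hsumm'.tsum_le_tsum hle hsumm
    _ = (∑' i : ℤ, volume (symmDiff A A' ∩ laySlab L s i)).toReal := (ENNReal.tsum_toReal_eq hterm_fin).symm
    _ = (volume (symmDiff A A')).toReal := by rw [hΔsum]
    _ ≤ 4 * Real.pi * ρ * τ := by
        have := ENNReal.toReal_mono ENNReal.ofReal_ne_top hΔ
        rwa [ENNReal.toReal_ofReal (by positivity)] at this

/-! ## The adjacent-mean corollary -/

/-- **The ADJACENT-MEAN flux sum versus the plain one.**  For rises `0 ≤ r_i ≤ R` and the strip volumes `v_i = |wallSlice ρ ∩ laySlab L s i|`: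
`Σ_i ½(r_i + r_{i+1})·v_i ≤ Σ_i r_i·v_i + (R/2)·4π·ρ·hB/ℓ` (both series converge). -/
theorem tsum_adjMean_mul_volume_le (L : E3 ≃ₗᵢ[ℝ] E3) (s : E3) {ρ : ℝ} (hρ : 0 ≤ ρ)
    (hℓ : 0 < (L e₃) 0 ^ 2 + (L e₃) 1 ^ 2) {r : ℤ → ℝ} {R : ℝ} (hr0 : ∀ i, 0 ≤ r i) (hrR : ∀ i, r i ≤ R) :
    Summable (fun i : ℤ => r i * (volume (wallSlice ρ ∩ laySlab L s i)).toReal) ∧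
    Summable (fun i : ℤ => (r i + r (i + 1)) / 2 * (volume (wallSlice ρ ∩ laySlab L s i)).toReal) ∧
    ∑' i : ℤ, (r i + r (i + 1)) / 2 * (volume (wallSlice ρ ∩ laySlab L s i)).toReal ≤
      ∑' i : ℤ, r i * (volume (wallSlice ρ ∩ laySlab L s i)).toReal + R / 2 * (4 * Real.pi * ρ * (hB / Real.sqrt ((L e₃) 0 ^ 2 + (L e₃) 1 ^ 2))) := by
  set v : ℤ → ℝ := fun i => (volume (wallSlice ρ ∩ laySlab L s i)).toReal with hv
  have hR0 : 0 ≤ R := (hr0 0).trans (hrR 0)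
  have hv0 : ∀ i, 0 ≤ v i := fun i => ENNReal.toReal_nonneg
  -- the strip volumes are summable (they sum to |wallSlice ρ|)
  have hVsum : volume (wallSlice ρ) = ∑' i : ℤ, volume (wallSlice ρ ∩ laySlab L s i) :=
    measure_eq_tsum_inter_laySlab L s _ (measurableSet_wallSlice ρ)
  have hVfin : ∑' i : ℤ, volume (wallSlice ρ ∩ laySlab L s i) ≠ ⊤ := by
    rw [← hVsum, volume_wallSlice ρ hρ]; exact ENNReal.ofReal_ne_top
  have hvs : Summable v := ENNReal.summable_toReal hVfin
  -- summability of the weighted sums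
  have hs1 : Summable fun i : ℤ => r i * v i :=
    Summable.of_nonneg_of_le (fun i => mul_nonneg (hr0 i) (hv0 i)) (fun i => by
      have := mul_le_mul_of_nonneg_right (hrR i) (hv0 i); exact this) (hvs.mul_left R)
  have hs2 : Summable fun i : ℤ => r (i + 1) * v i :=
    Summable.of_nonneg_of_le (fun i => mul_nonneg (hr0 _) (hv0 i)) (fun i => mul_le_mul_of_nonneg_right (hrR _) (hv0 i))
      (hvs.mul_left R)
  have hs3 : Summable fun i : ℤ => r (i + 1) * v (i + 1) := by
    have := (Equiv.addRight (1 : ℤ)).summable_iff.2 hs1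
    exact this
  obtain ⟨hTV, hTVle⟩ := tsum_abs_sub_volume_wallSlice_laySlab_le L s hρ hℓ
  have hs4 : Summable fun i : ℤ => r (i + 1) * (v i - v (i + 1)) := by
    have h := hs2.sub hs3
    refine h.congr (fun i => by ring)
  have hmean : ∀ i, (r i + r (i + 1)) / 2 * v i = (1 / 2) * (r i * v i) + (1 / 2) * (r (i + 1) * v i) := fun i => by ring
  have hs5 : Summable fun i : ℤ => (r i + r (i + 1)) / 2 * v i := by
    simp only [hmean]; exact (hs1.mul_left _).add (hs2.mul_left _)
  refine ⟨hs1, hs5, ?_⟩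
  -- Σ r_{i+1} v_i = Σ r_{i+1} v_{i+1} + Σ r_{i+1}(v_i − v_{i+1}) ≤ Σ r_i v_i + R·TV
  have hreindex : ∑' i : ℤ, r (i + 1) * v (i + 1) = ∑' i : ℤ, r i * v i :=
    (Equiv.addRight (1 : ℤ)).tsum_eq (fun i => r i * v i)
  have hsplit : ∑' i : ℤ, r (i + 1) * v i = ∑' i : ℤ, r (i + 1) * v (i + 1) + ∑' i : ℤ, r (i + 1) * (v i - v (i + 1)) := by
    rw [← hs3.tsum_add hs4]; congr 1; funext i; ring
  have herr : ∑' i : ℤ, r (i + 1) * (v i - v (i + 1)) ≤ R * (4 * Real.pi * ρ * (hB / Real.sqrt ((L e₃) 0 ^ 2 + (L e₃) 1 ^ 2))) := by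
    calc ∑' i : ℤ, r (i + 1) * (v i - v (i + 1)) ≤ ∑' i : ℤ, R * |v i - v (i + 1)| := by
          refine hs4.tsum_le_tsum (fun i => ?_) (hTV.mul_left R)
          calc r (i + 1) * (v i - v (i + 1)) ≤ r (i + 1) * |v i - v (i + 1)| :=
                mul_le_mul_of_nonneg_left (le_abs_self _) (hr0 _)
            _ ≤ R * |v i - v (i + 1)| := mul_le_mul_of_nonneg_right (hrR _) (abs_nonneg _)
      _ = R * ∑' i : ℤ, |v i - v (i + 1)| := tsum_mul_left
      _ ≤ R * (4 * Real.pi * ρ * (hB / Real.sqrt ((L e₃) 0 ^ 2 + (L e₃) 1 ^ 2))) := mul_le_mul_of_nonneg_left hTVle hR0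
  have hmain : ∑' i : ℤ, (r i + r (i + 1)) / 2 * v i = (1 / 2) * ∑' i : ℤ, r i * v i + (1 / 2) * ∑' i : ℤ, r (i + 1) * v i := by
    simp only [hmean]
    rw [((hs1.mul_left _).tsum_add (hs2.mul_left _)), tsum_mul_left, tsum_mul_left]
  rw [hmain, hsplit, hreindex]
  linarith

end Summit.Ventures.Crystal3D.Theorems

end
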